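import Summits.BirchSwinnertonDyer.BirchSwinnertonDyer.Theses.SignedLowerHalves
import Summits.BirchSwinnertonDyer.Rank1Residual.Supersingular.SharpFlatRankZeroReal
import Literature.NumberTheory.EllipticCurves.Sprung2017.SharpFlatPAdicLFunctionProofs
import Literature.NumberTheory.EllipticCurves.ModularCurve
import Literature.NumberTheory.EllipticCurves.ModularCurveNeronLatticeProofs
import Literature.NumberTheory.EllipticCurves.ModularParametrizationDegreeHoldsProofs
import Literature.NumberTheory.EllipticCurves.ModularCurveManinSemistableLatticeFormProofs
import Literature.NumberTheory.EllipticCurves.LeadingTermPPartProofs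
import HarnessLib

/-!
# Route `SignedLowerHalves`, crux `SprungLowerHalfAtThree` (item stmt-BirchSwinnertonDyer-19003): the
# registered stub `stub_sprungPair` (clause (A): the REAL OBJECTS of an X8 pair) VERBATIM, MODULO
# MODULARITY ALONE (cell `bsd-ssimc`, PROGRAMME PART 1b seat `bsd-ssimc-k3c5-sprungpair`; a
# `--supports … --as helper` file, closes nothing)

PARTITION (cell bsd-ssimc): X8 (A8) — `p = 3`, good supersingular, `a_3 = ±3`, at EVERY analytic rank
(crux 5 is typed rank-free) — kernel glue for stub (A) of the registered BC3 skeleton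
`Cruxes/SprungLowerHalfAtThree/Lines/birth.lean` (skeleton sha `c0fa77bad7ad`); types-the-object-of;
closes NONE. THEOREMS ONLY; nothing is booked; BSD is not proved by any of this.

The registered stub asks, for every X8 pair `(W, 3)`: a level `N ≥ 1`, a newform `f ∈ S₂(Γ₀(N))` of `W`
(`IsNewformOf W f`), a RATIONAL period ratio `ϖ` with `ϖ · Ω_W = Ω⁺_f` (no unit condition is part of
the stub), and a Sprung pair `(L♯, L♭) ∈ Λ²` for `(f, 3, a_3(W))` (`Sprung2017.IsSprungPair`, the
Mazur–Tate characterisation). The earlier helper `stub_sprungPair_of_modularity_of_periodUnit`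
(`…SprungLowerHalfAtThreeSprungPair.lean`, p417663) proved it behind TWO published binders — modularity
and the `3`-adic period-unit fact `realPeriodRat_eq_unit_mul_plusPeriod_three` (Greenberg–Vatsal
Rem. 3.4 / Mazur Cor. 4.1), the latter used only to produce `ϖ`. This file removes the second binder:

* the ♯/♭ PAIR is a tree THEOREM — `Sprung2017.thm112_exists_isSprungPair_holds` (Sprung 2017
  Thm. 1.12 in Mazur–Tate form, Cor. 4.4–4.5/4.10–4.11; for an elliptic curve this is the pair of
  Sprung 2012 JNT §§5–6, there built as `Col^{♯/♭}` of Kato's element, Def. 6.1 ff. / Thm. 6.12), so NO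
  named fact is typed for it (a second `def … : Prop` would restate a tree declaration);
* the RATIONALITY `Ω⁺_f / Ω_W ∈ ℚ_{>0}` for EVERY newform `f` of an elliptic `W/ℚ` is a tree THEOREM
  (`exists_pos_periodRatio_of_isNewformOf` below): a Néron-type period pair `Λ_E` exists
  (`exists_isNeronLatticeOf_holds`, AEC VI.5.1), some non-zero integer `c` has `c Λ_f ⊆ Λ_E`
  (`IsNewformOf.exists_maninConstant_ne_zero_holds` = BCDT 2001 p. 845 "(2) ⇒ (6)", PROVED in the tree
  from Shimura's construction, Honda's congruence and Faltings), hence a parametrisation datum `D` with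
  `D.f = f` (`ModularParametrizationData.exists_of_isNewformOf`) and Edixhoven's period relation
  `m · Ω(W) = |c| · Ω⁺_f`, `0 < m` (`ModularParametrizationData.exists_rat_mul_realPeriodRat_eq_plusPeriod`,
  from `realPeriodRat_dvd_holds`), i.e. `ϖ = m/|c|`.

Consequently stub (A) holds VERBATIM modulo MODULARITY ALONE, in the three spellings the route uses:
`exists_isNewformOf →` (BCDT Thm. A, existence half — the weakest form), the route's HELD support
`ModularParametrizationSupply →` (= `nonempty_modularParametrizationData`, item 19266, a conjunct of
`PublishedSignedInputs`), and `PublishedSignedInputs →` (the binder `hPub` of the deciding theorem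
`closes`). The item OWNER plugs any of them into the first `obtain` of `SprungLowerHalfAtThree_of`; crux 5
then rests on stub (B) `stub_chromaticDivisibility` alone (which, where it needs `|ϖ|_3 = 1`, keeps the
period-unit fact — see `…ChromaticReduction.lean`). The crux item stays OPEN on the ledger (its own
signature is not proved here: modularity is a named fact, D-0014).

References: [Sprung2017] Thm. 1.12, Cor. 4.4–4.5, 4.10–4.11; [Sprung2012] §§5–6; [BCDTJAMS2001] Thm. A
and p. 845 (2) ⇒ (6); [EdixhovenManin1991] §1, Prop. 2; [SilvermanAEC2009] Thm. VI.5.1;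
[CremonaAlgorithms1997] §2.8, §2.10.
-/

set_option autoImplicit false
set_option linter.dupNamespace false

noncomputable section

open scoped Classical MatrixGroups ModularForm

open CongruenceSubgroup WeierstrassCurve Literature.NumberTheory.EllipticCurves
  Literature.NumberTheory.EllipticCurves.ModularForms
  Literature.NumberTheory.EllipticCurves.Rank1Residual
  Literature.NumberTheory.EllipticCurves.Sprung2017
  Summit.BirchSwinnertonDyer.Rank1Residual.Supersingular

namespace Summit.BirchSwinnertonDyer.BirchSwinnertonDyer.Theorems

/-! ### The period ratio of ANY newform of `W` is a positive rational (no named fact) -/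

/-- **`Ω⁺_f = ϖ · Ω(W)` with `ϖ ∈ ℚ_{>0}`, for every newform `f` of an elliptic `W/ℚ`** — a THEOREM of
the tree, no hypothesis beyond `IsNewformOf W f`: take a Néron-type period pair `Λ_E` of `W`
(`exists_isNeronLatticeOf_holds`), a non-zero `c ∈ ℤ` with `c Λ_f ⊆ Λ_E`
(`IsNewformOf.exists_maninConstant_ne_zero_holds`, BCDT p. 845 (2) ⇒ (6)), the parametrisation datum
`D` with `D.f = f` they determine (`ModularParametrizationData.exists_of_isNewformOf`) and Edixhoven's
period relation `m · Ω(W) = |c| · Ω⁺_f`, `0 < m`, in the form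
`ModularParametrizationData.exists_rat_mul_realPeriodRat_eq_plusPeriod`. Also records `Ω(W) > 0`.
[cite: BCDTJAMS2001, p. 845 (2) ⇒ (6)] [cite: EdixhovenManin1991, §1] -/
theorem exists_pos_periodRatio_of_isNewformOf (W : WeierstrassCurve ℚ) [W.IsElliptic] {N : ℕ}
    [NeZero N] (f : CuspForm (Gamma0 N) 2) (hf : IsNewformOf W f) :
    ∃ ϖ : ℚ, 0 < ϖ ∧ (ϖ : ℝ) * W.realPeriodRat = plusPeriod f ∧ 0 < W.realPeriodRat := by
  haveI : (W.baseChange ℂ).IsElliptic := by rw [WeierstrassCurve.baseChange]; infer_instance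
  obtain ⟨L, hL⟩ := exists_isNeronLatticeOf_holds (W.baseChange ℂ)
  obtain ⟨c, hc0, hc⟩ := IsNewformOf.exists_maninConstant_ne_zero_holds hf hL
  obtain ⟨D, hDf, -, -⟩ := ModularParametrizationData.exists_of_isNewformOf hf hL hc0 hc
  obtain ⟨ϖ, hϖpos, hϖ, hΩ⟩ := D.exists_rat_mul_realPeriodRat_eq_plusPeriod
  exact ⟨ϖ, hϖpos, by rw [hϖ, hDf], hΩ⟩

/-! ### Clause (A) for a GIVEN newform of an X8 pair (unconditional in the newform) -/

/-- **The real objects of an X8 pair, for a GIVEN newform, with NO named fact.** On class X8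
(`p = 3`, good supersingular, `a_3 = ±3`), for `f ∈ S₂(Γ₀(N))` a newform of `W` (`IsNewformOf W f`):
the period ratio `ϖ ∈ ℚ_{>0}` with `ϖ · Ω_W = Ω⁺_f` (`exists_pos_periodRatio_of_isNewformOf`) and a
Sprung pair `(L♯, L♭)` for `(f, 3, a_3)` (tree theorem `thm112_exists_isSprungPair_holds`: `3` is odd,
good, and `3 ∣ a_3` on X8). Unconditional given `hf`. [cite: Sprung2017, Thm. 1.12 and Cor. 4.4]
[cite: EdixhovenManin1991, §1] -/
theorem X8_pos_periodRatio_and_sprungPair_of_isNewformOf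
    (W : WeierstrassCurve ℚ) [W.IsElliptic] [W.IsGloballyMinimal] (p : ℕ) [Fact p.Prime]
    (hX : ClassX8 W p) {N : ℕ} [NeZero N] (f : CuspForm (Gamma0 N) 2) (hf : IsNewformOf W f) :
    ∃ (ϖ : ℚ) (Lsharp Lflat : IwasawaAlgebra p),
      0 < ϖ ∧ (ϖ : ℝ) * W.realPeriodRat = plusPeriod f ∧
        IsSprungPair f p (W.frobeniusTrace p) Lsharp Lflat := by
  have hp3 : p = 3 := hX.1
  subst hp3
  have hgood : W.HasGoodReductionAtPrime 3 := hX.2.1.1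
  have hdvd : ((3 : ℕ) : ℤ) ∣ W.frobeniusTrace 3 := hX.2.1.2
  obtain ⟨ϖ, hϖpos, hϖ, -⟩ := exists_pos_periodRatio_of_isNewformOf W f hf
  obtain ⟨Lsharp, Lflat, hSP⟩ :=
    thm112_exists_isSprungPair_holds (W := W) (f := f) (p := 3) (by decide) hf hgood hdvd
  exact ⟨ϖ, Lsharp, Lflat, hϖpos, hϖ, hSP⟩

/-- **Stub (A)'s conclusion for a GIVEN newform** (the shape the owner's `obtain` consumes, at the
level `N` of `f`): on X8, any newform `f` of `W` at a level `N ≥ 1` yields the stub's witnesses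
`(N, f, ϖ, L♯, L♭)`. Unconditional given `hf`. [cite: Sprung2017, Thm. 1.12 and Cor. 4.4]
[cite: EdixhovenManin1991, §1] -/
theorem stub_sprungPair_of_isNewformOf
    (W : WeierstrassCurve ℚ) [W.IsElliptic] [W.IsGloballyMinimal] (p : ℕ) [Fact p.Prime]
    (hX : ClassX8 W p) {N : ℕ} [hN : NeZero N] (f : CuspForm (Gamma0 N) 2) (hf : IsNewformOf W f) :
    ∃ (N : ℕ) (_ : NeZero N) (f : CuspForm (CongruenceSubgroup.Gamma0 N) 2) (ϖ : ℚ)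
      (Lsharp Lflat : Literature.NumberTheory.EllipticCurves.IwasawaAlgebra p),
      Literature.NumberTheory.EllipticCurves.ModularForms.IsNewformOf W f ∧
      (ϖ : ℝ) * W.realPeriodRat = Literature.NumberTheory.EllipticCurves.ModularForms.plusPeriod f ∧
      Literature.NumberTheory.EllipticCurves.Sprung2017.IsSprungPair f p (W.frobeniusTrace p)
        Lsharp Lflat := by
  obtain ⟨ϖ, Lsharp, Lflat, -, hϖ, hSP⟩ := X8_pos_periodRatio_and_sprungPair_of_isNewformOf W p hX f hf
  exact ⟨N, hN, f, ϖ, Lsharp, Lflat, hf, hϖ, hSP⟩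

/-! ### The registered stub VERBATIM, modulo modularity alone (three spellings) -/

/-- **`stub_sprungPair` (verbatim header) MODULO MODULARITY ALONE — weakest form.** With
`hmod : exists_isNewformOf` (the Modularity Theorem, existence half: a newform of level `N_W` with
`aₙ(f) = aₙ(W)`; `N_W ≥ 1` by the tree theorem `conductorNorm_pos_holds`) every X8 pair has the real
objects of crux 5's clause (A). The statement after the binder is the registered stub
`Summit.….Cruxes.SprungLowerHalfAtThree.Birth.stub_sprungPair` VERBATIM; no period fact is used.
CONDITIONAL on modularity only; closes nothing. [cite: BCDTJAMS2001, Thm. A]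
[cite: Sprung2017, Thm. 1.12 and Cor. 4.4] [cite: EdixhovenManin1991, §1] -/
theorem stub_sprungPair_of_modularity (hmod : exists_isNewformOf) :
    ∀ (W : WeierstrassCurve ℚ) [W.IsElliptic] [W.IsGloballyMinimal] (p : ℕ) [Fact p.Prime],
      Literature.NumberTheory.EllipticCurves.Rank1Residual.ClassX8 W p →
      ∃ (N : ℕ) (_ : NeZero N) (f : CuspForm (CongruenceSubgroup.Gamma0 N) 2) (ϖ : ℚ)
        (Lsharp Lflat : Literature.NumberTheory.EllipticCurves.IwasawaAlgebra p),
        Literature.NumberTheory.EllipticCurves.ModularForms.IsNewformOf W f ∧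
        (ϖ : ℝ) * W.realPeriodRat = Literature.NumberTheory.EllipticCurves.ModularForms.plusPeriod f ∧
        Literature.NumberTheory.EllipticCurves.Sprung2017.IsSprungPair f p (W.frobeniusTrace p)
          Lsharp Lflat := by
  intro W _ _ p _ hX
  haveI hN : NeZero (W.conductorNorm ℤ) := ⟨(W.conductorNorm_pos_holds).ne'⟩
  obtain ⟨f, hf⟩ := hmod W
  exact stub_sprungPair_of_isNewformOf W p hX f hf

/-- **`stub_sprungPair` (verbatim header) MODULO the route's HELD modularity support
`ModularParametrizationSupply`** (= `nonempty_modularParametrizationData`, item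
stmt-BirchSwinnertonDyer-19266, the eighth conjunct of `PublishedSignedInputs`; the datum carries the
newform `D.f` with `D.isNewformOf`). This is the binder the owner's `SprungLowerHalfAtThree_of` can take
as its first hypothesis. CONDITIONAL on modularity only; closes nothing. [cite: BCDTJAMS2001, Thm. A]
[cite: Sprung2017, Thm. 1.12 and Cor. 4.4] [cite: EdixhovenManin1991, §1] -/
theorem stub_sprungPair_of_modularParametrizationSupply
    (hmodP : Summit.BirchSwinnertonDyer.BirchSwinnertonDyer.Theses.SignedLowerHalves.ModularParametrizationSupply) :
    ∀ (W : WeierstrassCurve ℚ) [W.IsElliptic] [W.IsGloballyMinimal] (p : ℕ) [Fact p.Prime],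
      Literature.NumberTheory.EllipticCurves.Rank1Residual.ClassX8 W p →
      ∃ (N : ℕ) (_ : NeZero N) (f : CuspForm (CongruenceSubgroup.Gamma0 N) 2) (ϖ : ℚ)
        (Lsharp Lflat : Literature.NumberTheory.EllipticCurves.IwasawaAlgebra p),
        Literature.NumberTheory.EllipticCurves.ModularForms.IsNewformOf W f ∧
        (ϖ : ℝ) * W.realPeriodRat = Literature.NumberTheory.EllipticCurves.ModularForms.plusPeriod f ∧
        Literature.NumberTheory.EllipticCurves.Sprung2017.IsSprungPair f p (W.frobeniusTrace p)
          Lsharp Lflat := by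
  intro W _ _ p _ hX
  haveI hN : NeZero (W.conductorNorm ℤ) := ⟨(W.conductorNorm_pos_holds).ne'⟩
  obtain ⟨D⟩ := hmodP W
  exact stub_sprungPair_of_isNewformOf W p hX D.f D.isNewformOf

/-- **`stub_sprungPair` (verbatim header) MODULO the Literature spelling
`nonempty_modularParametrizationData`** of the same support (definitionally the previous theorem; stated
so that consumers opening only the Literature namespace find it). CONDITIONAL on modularity only; closes
nothing. [cite: BCDTJAMS2001, Thm. A] [cite: Sprung2017, Thm. 1.12 and Cor. 4.4]
[cite: EdixhovenManin1991, §1] -/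
theorem stub_sprungPair_of_modularParametrization (hmodP : nonempty_modularParametrizationData) :
    ∀ (W : WeierstrassCurve ℚ) [W.IsElliptic] [W.IsGloballyMinimal] (p : ℕ) [Fact p.Prime],
      Literature.NumberTheory.EllipticCurves.Rank1Residual.ClassX8 W p →
      ∃ (N : ℕ) (_ : NeZero N) (f : CuspForm (CongruenceSubgroup.Gamma0 N) 2) (ϖ : ℚ)
        (Lsharp Lflat : Literature.NumberTheory.EllipticCurves.IwasawaAlgebra p),
        Literature.NumberTheory.EllipticCurves.ModularForms.IsNewformOf W f ∧
        (ϖ : ℝ) * W.realPeriodRat = Literature.NumberTheory.EllipticCurves.ModularForms.plusPeriod f ∧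
        Literature.NumberTheory.EllipticCurves.Sprung2017.IsSprungPair f p (W.frobeniusTrace p)
          Lsharp Lflat :=
  stub_sprungPair_of_modularParametrizationSupply hmodP

/-- **`stub_sprungPair` (verbatim header) from the deciding theorem's binder `hPub : PublishedSignedInputs`**
(projection to its eighth conjunct `nonempty_modularParametrizationData`; the other nine conjuncts are
not used). CONDITIONAL on that conjunction; closes nothing. [cite: BCDTJAMS2001, Thm. A]
[cite: Sprung2017, Thm. 1.12 and Cor. 4.4] [cite: EdixhovenManin1991, §1] -/
theorem stub_sprungPair_of_publishedSignedInputs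
    (hPub : Summit.BirchSwinnertonDyer.BirchSwinnertonDyer.Theses.SignedLowerHalves.PublishedSignedInputs) :
    ∀ (W : WeierstrassCurve ℚ) [W.IsElliptic] [W.IsGloballyMinimal] (p : ℕ) [Fact p.Prime],
      Literature.NumberTheory.EllipticCurves.Rank1Residual.ClassX8 W p →
      ∃ (N : ℕ) (_ : NeZero N) (f : CuspForm (CongruenceSubgroup.Gamma0 N) 2) (ϖ : ℚ)
        (Lsharp Lflat : Literature.NumberTheory.EllipticCurves.IwasawaAlgebra p),
        Literature.NumberTheory.EllipticCurves.ModularForms.IsNewformOf W f ∧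
        (ϖ : ℝ) * W.realPeriodRat = Literature.NumberTheory.EllipticCurves.ModularForms.plusPeriod f ∧
        Literature.NumberTheory.EllipticCurves.Sprung2017.IsSprungPair f p (W.frobeniusTrace p)
          Lsharp Lflat :=
  stub_sprungPair_of_modularParametrizationSupply hPub.2.2.2.2.2.2.2.1

/-! ### «Crux 5 rests on stub (B) alone», in the kernel -/

/-- **The route decl `SprungLowerHalfAtThree` BY NAME from the HELD modularity support and the
registered stub (B) VERBATIM** — the skeleton's composition `SprungLowerHalfAtThree_of` with its first
`obtain` fed by `stub_sprungPair_of_modularParametrizationSupply`: granted `ModularParametrizationSupply`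
(item 19266, published, HELD) the crux is implied by `stub_chromaticDivisibility` alone (hypothesis `hB`,
whose type is the registered stub (B) signature verbatim). CONDITIONAL (modularity + the open stub (B));
closes nothing — the owner's assembly replaces `hB` by the stub's proof when it lands.
[cite: BCDTJAMS2001, Thm. A] [cite: Sprung2017, Thm. 1.12 and Cor. 4.4] [cite: EdixhovenManin1991, §1] -/
theorem sprungLowerHalfAtThree_of_modularParametrizationSupply_of_chromaticDivisibility
    (hmodP : Summit.BirchSwinnertonDyer.BirchSwinnertonDyer.Theses.SignedLowerHalves.ModularParametrizationSupply)
    (hB : ∀ (W : WeierstrassCurve ℚ) [W.IsElliptic] [W.IsGloballyMinimal] (p : ℕ) [Fact p.Prime],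
      Literature.NumberTheory.EllipticCurves.Rank1Residual.ClassX8 W p →
      ∀ (N : ℕ) (_ : NeZero N) (f : CuspForm (CongruenceSubgroup.Gamma0 N) 2) (ϖ : ℚ)
        (Lsharp Lflat : Literature.NumberTheory.EllipticCurves.IwasawaAlgebra p),
        Literature.NumberTheory.EllipticCurves.ModularForms.IsNewformOf W f →
        (ϖ : ℝ) * W.realPeriodRat = Literature.NumberTheory.EllipticCurves.ModularForms.plusPeriod f →
        Literature.NumberTheory.EllipticCurves.Sprung2017.IsSprungPair f p (W.frobeniusTrace p)
          Lsharp Lflat →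
        ∃ (c : Literature.NumberTheory.EllipticCurves.Sprung2017.Chroma)
          (ξ : Literature.NumberTheory.EllipticCurves.IwasawaAlgebra p),
          (⟨ξ, 0, 0⟩ : Summit.BirchSwinnertonDyer.Rank1Residual.Supersingular.SignedDatum W p).EulerCharacteristic ∧
          ∃ h : Literature.NumberTheory.EllipticCurves.IwasawaAlgebra p,
            Literature.NumberTheory.EllipticCurves.iwasawaToPowerSeries p ξ =
              PowerSeries.C (ϖ : ℚ_[p]) *
                Literature.NumberTheory.EllipticCurves.iwasawaToPowerSeries p
                  (Literature.NumberTheory.EllipticCurves.Sprung2017.chromaticL c Lsharp Lflat * h)) :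
    Summit.BirchSwinnertonDyer.BirchSwinnertonDyer.Theses.SignedLowerHalves.SprungLowerHalfAtThree := by
  unfold Summit.BirchSwinnertonDyer.BirchSwinnertonDyer.Theses.SignedLowerHalves.SprungLowerHalfAtThree
  intro W _ _ p _ hX
  obtain ⟨N, hN, f, ϖ, Lsharp, Lflat, hf, hϖ, hSP⟩ :=
    stub_sprungPair_of_modularParametrizationSupply hmodP W p hX
  obtain ⟨c, ξ, hK, hdiv⟩ := hB W p hX N hN f ϖ Lsharp Lflat hf hϖ hSP
  exact ⟨N, hN, f, ϖ, Lsharp, Lflat, c, ξ, hf, hϖ, hSP, hK, hdiv⟩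

/-- **The same with the deciding theorem's binder `hPub : PublishedSignedInputs`** in place of its
modularity conjunct: `PublishedSignedInputs ∧ stub (B) ⟹ SprungLowerHalfAtThree` by name. CONDITIONAL;
closes nothing. [cite: BCDTJAMS2001, Thm. A] [cite: Sprung2017, Thm. 1.12 and Cor. 4.4]
[cite: EdixhovenManin1991, §1] -/
theorem sprungLowerHalfAtThree_of_publishedSignedInputs_of_chromaticDivisibility
    (hPub : Summit.BirchSwinnertonDyer.BirchSwinnertonDyer.Theses.SignedLowerHalves.PublishedSignedInputs)
    (hB : ∀ (W : WeierstrassCurve ℚ) [W.IsElliptic] [W.IsGloballyMinimal] (p : ℕ) [Fact p.Prime],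
      Literature.NumberTheory.EllipticCurves.Rank1Residual.ClassX8 W p →
      ∀ (N : ℕ) (_ : NeZero N) (f : CuspForm (CongruenceSubgroup.Gamma0 N) 2) (ϖ : ℚ)
        (Lsharp Lflat : Literature.NumberTheory.EllipticCurves.IwasawaAlgebra p),
        Literature.NumberTheory.EllipticCurves.ModularForms.IsNewformOf W f →
        (ϖ : ℝ) * W.realPeriodRat = Literature.NumberTheory.EllipticCurves.ModularForms.plusPeriod f →
        Literature.NumberTheory.EllipticCurves.Sprung2017.IsSprungPair f p (W.frobeniusTrace p)
          Lsharp Lflat →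
        ∃ (c : Literature.NumberTheory.EllipticCurves.Sprung2017.Chroma)
          (ξ : Literature.NumberTheory.EllipticCurves.IwasawaAlgebra p),
          (⟨ξ, 0, 0⟩ : Summit.BirchSwinnertonDyer.Rank1Residual.Supersingular.SignedDatum W p).EulerCharacteristic ∧
          ∃ h : Literature.NumberTheory.EllipticCurves.IwasawaAlgebra p,
            Literature.NumberTheory.EllipticCurves.iwasawaToPowerSeries p ξ =
              PowerSeries.C (ϖ : ℚ_[p]) *
                Literature.NumberTheory.EllipticCurves.iwasawaToPowerSeries p
                  (Literature.NumberTheory.EllipticCurves.Sprung2017.chromaticL c Lsharp Lflat * h)) :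
    Summit.BirchSwinnertonDyer.BirchSwinnertonDyer.Theses.SignedLowerHalves.SprungLowerHalfAtThree :=
  sprungLowerHalfAtThree_of_modularParametrizationSupply_of_chromaticDivisibility hPub.2.2.2.2.2.2.2.1 hB

end Summit.BirchSwinnertonDyer.BirchSwinnertonDyer.Theorems

end
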